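import Summits.BirchSwinnertonDyer.BirchSwinnertonDyer.Theses.AlignedTransportAtTwo

/-!
# Route AlignedTransportAtTwo — the Assembly item

The assembly statement of route `AlignedTransportAtTwo` (item stmt-BirchSwinnertonDyer-22300) is the curried
form of the route's deciding theorem `closes`: the four cruxes imply the registered leaf
`Summit.BirchSwinnertonDyer.WAllNonCMAtTwoOffThetaHabitat`. Pure logic; no mathematics beyond `closes`.
This does NOT prove BSD or any crux of the route.
-/

namespace Summit.BirchSwinnertonDyer.BirchSwinnertonDyer.Theorems

/-- The Assembly of route `AlignedTransportAtTwo` holds: it is literally the deciding theorem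
`Theses.AlignedTransportAtTwo.closes` (C1 → C2 → C3 → R → leaf `WAllNonCMAtTwoOffThetaHabitat`). -/
theorem alignedTransportAtTwo_assembly_proof :
    Summit.BirchSwinnertonDyer.BirchSwinnertonDyer.Theses.AlignedTransportAtTwo.Assembly := by
  unfold Summit.BirchSwinnertonDyer.BirchSwinnertonDyer.Theses.AlignedTransportAtTwo.Assembly
  exact Summit.BirchSwinnertonDyer.BirchSwinnertonDyer.Theses.AlignedTransportAtTwo.closes

end Summit.BirchSwinnertonDyer.BirchSwinnertonDyer.Theorems
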